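import Mathlib.Topology.Algebra.ContinuousMonoidHom
import Literature.AlgebraicGeometry.Frobenioids.Categories
import Literature.AnabelianGeometry.AbsoluteAnabelian.FundamentalExtension
import Literature.AnabelianGeometry.AbsoluteAnabelian.ProfiniteTerminology
import Literature.AnabelianGeometry.AbsoluteAnabelian.AbsTopISemiAbsolute
import Literature.AnabelianGeometry.AbsoluteAnabelian.AbsTopII.InertiaGroups

/-!
# [AbsTopI] §4 "Chains of Elementary Operations": Def 4.2 (Π-chains), Lemma 4.5, Example 4.8
# — the IUT-cited items (Prop 4.10: see `AbsTopITemperedCusps.lean`)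

S. Mochizuki, *Topics in Absolute Anabelian Geometry I: Generalities* (2012) [AbsTopI] §4
pp. 45–65, manuscript pagination (lit key paper:url-11ac98ba15fc).  What §4 supplies (cited as
"[AbsTopI], §4" by [IUTchII] p. 32, [IUTchIV] p. 65): the calculus of *chains of elementary
operations* `X₀ ⇝ X₁ ⇝ ⋯ ⇝ Xₙ` — finite étale coverings (⋏), finite étale quotients (⋎),
de-cuspidalisations (•), de-orbifications (⊚) — applied to a hyperbolic orbicurve, their purely
group-theoretic counterparts (Π-chains, Def 4.2 (iii)–(v)), the categories `Chain(Π)`,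
`ÉtLoc(Π)`, `DLoc(Π)`, and Thm 4.7: under the relative isomorphism version of the Grothendieck
conjecture the group-theoretic chains are EQUIVALENT to the scheme-theoretic ones
(semi-absoluteness), which for hyperbolic orbicurves over (generalized) sub-`p`-adic fields is
Example 4.8; Lemma 4.5 is the group-theoretic characterisation of decomposition groups of cusps
(the most-cited item of this file's slice: [IUTchI] ×9, [IUTchII]); Prop 4.10 is the tempered
version.

Typing (HOME/plan/L4/ASSIGNMENTS.md §2, ruling θ): everything is over abc-iut-L4-t1's abstract
`FundamentalExtension` / `CuspidalData`; the scheme side (`X̃/X`-chains, Def 4.2 (i)–(ii); the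
equivalences `Chain(X̃/X) ≃ Chain(Π)` of Thm 4.7 (i),(iii); the rel-isom/hom-GC of Def 4.6) is
the model-relative comparison that waits for the étale-`π₁` model (FOUNDATIONS row 12) and is NOT
typed here.  REAL definitions: `ElemOpType`/`TypeChain`, `ChainGroup` (a rigidified group
`Πⱼ` over `Π`, Def 4.2 (iii) (0_Π)–(2_Π)), its cuspidal decomposition groups (3_Π), the four
elementary operations (a)–(d), `PiChain`.  PREDICATES / ALGORITHM STRUCTURES: Lemma 4.5 (i) (`NonProperIffFree`),
(iv) [as amended in [IUTchI] Rmk 1.2.2 (ii) p. 40] (v) (vi) (`CuspidalAlgorithm`,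
`RecoversCusps`, `DecompEqCommensuratorOfInertia`); Ex 4.8 as a section docstring pointing to
abc-iut-L4-t13's `RelativeGrothendieckConjecture.lean` (sub-`p`-adic fields, rel-isom/hom-GC,
slimness of `G_k`).  Deliberately NOT here: Lemma 4.1, Prop 4.3, Ex 4.4, Def 4.6,
Thm 4.7, Ex 4.9, Def 4.11–Thm 4.12 (tempered chains) beyond Prop 4.10; Lemma 4.5 (i)–(iii) (the
`ℚ_l[G]`-module invariants `τ`, `d_χ` need continuous `ℚ_l`-representations — the amended (iv)
is typed relative to an abstract "degree-of-cusp-divisor" function `d`, see `CuspCountData`).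
-/

noncomputable section

open Topology
open scoped Pointwise

universe u

namespace Literature.AnabelianGeometry.AbsoluteAnabelian

open Literature.AlgebraicGeometry.Frobenioids (IsSlimGroup)

/-! ### [AbsTopI] Def 4.2: type-chains -/

/-- The four types of elementary operations of [AbsTopI] Def 4.2 (i)/(iii): ⋏ (finite étale
covering), ⋎ (finite étale quotient), • (de-cuspidalization), ⊚ (de-orbification).
[cite: MochizukiAbsTopI2012, Def 4.2 (i) p.48] -/
inductive ElemOpType : Type
  /-- type ⋏: pass to a finite étale covering (open subgroup) -/
  | finEtCov
  /-- type ⋎: pass to a finite étale quotient (open overgroup) -/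
  | finEtQuot
  /-- type •: de-cuspidalization (quotient by a cuspidal decomposition group) -/
  | deCusp
  /-- type ⊚: de-orbification (quotient by a finite subgroup) -/
  | deOrb
  deriving DecidableEq

/-- The *type-chain* associated to a chain: "a sequence of symbols ∈ {⋏, ⋎, •, ⊚}"
([AbsTopI] Def 4.2 (i)/(iii)). [cite: MochizukiAbsTopI2012, Def 4.2 (iii) p.50] -/
abbrev TypeChain : Type := List ElemOpType

namespace FundamentalExtension

variable (E : FundamentalExtension.{u})

/-! ### [AbsTopI] Def 4.2 (iii): Π-chains -/

/-- One term `Πⱼ` of a Π-chain ([AbsTopI] Def 4.2 (iii)): a profinite group `Πⱼ` "equipped with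
an open rigidifying homomorphism `ρⱼ : Π̃ → Πⱼ` [i.e., an open homomorphism from some open
subgroup of `Π` to `Πⱼ`]" (here: `rig` on the open subgroup `dom`, with open image),
"(1_Π) a [uniquely determined] surjection `Πⱼ ↠ Gⱼ`, where `Gⱼ ⊆ G` is an open subgroup, that is
compatible with `ρⱼ` and `Π̃ → Π ↠ G`" (`proj`, `comm`), "(2_Π) each kernel `Δⱼ := Ker(Πⱼ ↠ Gⱼ)`
is slim and nontrivial" (the characteristic condition on the orders of finite quotients of `Δⱼ`
is vacuous in characteristic zero and omitted; slimness of `Πⱼ` itself, assumed in print, is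
recorded as `slim`; (3_Π) "each `Δⱼ` is a pro-`Σ` group" [when `X` is a hyperbolic orbicurve] is
NOT a field — no fact here quantifies over chains; a consumer needing it adds the hypothesis
`IsProSet L.geomJ Σ`). [cite: MochizukiAbsTopI2012, Def 4.2 (iii) p.49] -/
structure ChainGroup : Type (u + 1) where
  /-- the profinite group `Πⱼ` -/
  grp : ProfiniteGrp.{u}
  /-- `Πⱼ` is slim -/
  slim : IsSlimGroup grp
  /-- the open subgroup of `Π` on which the rigidifying homomorphism is defined -/
  dom : Subgroup E.arith
  /-- `dom` is open -/
  isOpen_dom : IsOpen (dom : Set E.arith)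
  /-- the rigidifying homomorphism `ρⱼ` -/
  rig : dom →ₜ* grp
  /-- `ρⱼ` is open (its image is an open subgroup) -/
  isOpen_range_rig : IsOpen (Set.range rig)
  /-- the surjection `Πⱼ ↠ Gⱼ ⊆ G`, as a homomorphism to `G` -/
  proj : grp →ₜ* E.gal
  /-- `Gⱼ = proj(Πⱼ)` is open in `G` -/
  isOpen_range_proj : IsOpen (Set.range proj)
  /-- compatibility of `Πⱼ → G` with `ρⱼ` and `Π ↠ G` -/
  comm : ∀ x : dom, proj (rig x) = E.aug x
  /-- `Δⱼ = Ker(Πⱼ → G)` is slim -/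
  slim_ker : IsSlimGroup proj.toMonoidHom.ker
  /-- `Δⱼ` is nontrivial -/
  ker_ne_bot : proj.toMonoidHom.ker ≠ ⊥

namespace ChainGroup

variable {E}

/-- `Δⱼ := Ker(Πⱼ ↠ Gⱼ)`. [cite: MochizukiAbsTopI2012, Def 4.2 (iii) p.49] -/
def geomJ (L : E.ChainGroup) : Subgroup L.grp := L.proj.toMonoidHom.ker

/-- `Π` itself as the initial term of every Π-chain: "(0_Π) `Π₀ = Π` [equipped with its natural
rigidifying homomorphism `Π̃ → Π`]" — here we need `Π`, `Δ` slim and `Δ ≠ 1` as inputs (they are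
hypotheses of Def 4.2: `G` slim, extension of GSAFG-type).
[cite: MochizukiAbsTopI2012, Def 4.2 (iii) p.49] -/
def self (hP : IsSlimGroup E.arith) (hΔ : IsSlimGroup E.geom) (hne : E.geom ≠ ⊥) :
    E.ChainGroup where
  grp := E.arith
  slim := hP
  dom := ⊤
  isOpen_dom := isOpen_univ
  rig := (ContinuousMonoidHom.id E.arith).comp
    ⟨(⊤ : Subgroup E.arith).subtype, continuous_subtype_val⟩
  isOpen_range_rig := by
    have : Set.range ((ContinuousMonoidHom.id E.arith).comp
        ⟨(⊤ : Subgroup E.arith).subtype, continuous_subtype_val⟩) = Set.univ := by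
      ext x; exact ⟨fun _ => trivial, fun _ => ⟨⟨x, trivial⟩, rfl⟩⟩
    rw [this]; exact isOpen_univ
  proj := E.aug
  isOpen_range_proj := by
    rw [Set.range_eq_univ.mpr E.aug_surjective]; exact isOpen_univ
  comm := fun _ => rfl
  slim_ker := hΔ
  ker_ne_bot := hne

/-- (3_Π) "a cuspidal decomposition group in `Δⱼ`": "any commensurator in `Δⱼ` of a nontrivial
image via `ρⱼ` of the inverse image in `Π̃` of the decomposition group in `Δ` of a cusp of `X`"
— relative to cuspidal data `C` on `E` (all `Π`-conjugates of the `D_x ∩ Δ` are used).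
[cite: MochizukiAbsTopI2012, Def 4.2 (iii) p.49] -/
def cuspidalDecompGroups (L : E.ChainGroup) (C : CuspidalData E) : Set (Subgroup L.grp) :=
  {D | ∃ (x : C.Cusp) (g : E.arith),
    let J : Subgroup L.grp :=
      (((MulAut.conj g • C.Dcusp x) ⊓ E.geom).subgroupOf L.dom).map L.rig.toMonoidHom
    J ≠ ⊥ ∧ D = (Subgroup.Commensurable.commensurator (J.subgroupOf L.geomJ)).map L.geomJ.subtype}

/-- Compatibility of an operation homomorphism `φ : Πⱼ → Πⱼ₊₁` with the rigidifying
homomorphisms: `φ ∘ ρⱼ = ρⱼ₊₁` on some open subgroup of `Π` contained in both domains.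
[cite: MochizukiAbsTopI2012, Def 4.2 (iii) p.49] -/
def RigCompat (L L' : E.ChainGroup) (φ : L.grp →ₜ* L'.grp) : Prop :=
  ∃ U : Subgroup E.arith, IsOpen (U : Set E.arith) ∧ ∃ (hU : U ≤ L.dom) (hU' : U ≤ L'.dom),
    ∀ x : U, φ (L.rig ⟨x, hU x.2⟩) = L'.rig ⟨x, hU' x.2⟩

/-- The kernel of `φ` is "topologically normally generated" by the subgroup `A`: it is the
closure of the normal closure of `A`. [cite: MochizukiAbsTopI2012, Def 4.2 (iii) p.50] -/
def KerTopNormallyGeneratedBy {L L' : E.ChainGroup} (φ : L.grp →ₜ* L'.grp)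
    (A : Subgroup L.grp) : Prop :=
  φ.toMonoidHom.ker = (Subgroup.normalClosure (A : Set L.grp)).topologicalClosure

/-- [AbsTopI] Def 4.2 (iii) (a)–(d): "`Πⱼ ⇝ Πⱼ₊₁` is an elementary operation" of the given type,
witnessed by an open operation homomorphism compatible with the rigidifying homomorphisms:
(a) ⋏ an open immersion `Πⱼ₊₁ ↪ Πⱼ`; (b) ⋎ an open immersion `Πⱼ ↪ Πⱼ₊₁`; (c) • a surjection
`Πⱼ ↠ Πⱼ₊₁` whose kernel is topologically normally generated by a cuspidal decomposition group
`C ⊆ Δⱼ` contained in some normal open torsion-free subgroup of `Δⱼ`; (d) ⊚ a surjection whose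
kernel is topologically normally generated by a finite closed subgroup of `Δⱼ` ("only defined
if `Σ = Primes`" — not enforced here). [cite: MochizukiAbsTopI2012, Def 4.2 (iii) p.50] -/
def IsElemOp (C : CuspidalData E) : ElemOpType → E.ChainGroup → E.ChainGroup → Prop
  | .finEtCov, L, L' => ∃ φ : L'.grp →ₜ* L.grp, Function.Injective φ ∧ IsOpen (Set.range φ) ∧
      RigCompat L' L φ
  | .finEtQuot, L, L' => ∃ φ : L.grp →ₜ* L'.grp, Function.Injective φ ∧ IsOpen (Set.range φ) ∧
      RigCompat L L' φ
  | .deCusp, L, L' => ∃ φ : L.grp →ₜ* L'.grp, Function.Surjective φ ∧ RigCompat L L' φ ∧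
      ∃ D ∈ L.cuspidalDecompGroups C, KerTopNormallyGeneratedBy φ D ∧
        ∃ N : Subgroup L.grp, N ≤ L.geomJ ∧ (N.subgroupOf L.geomJ).Normal ∧
          IsOpen ((N.subgroupOf L.geomJ : Subgroup L.geomJ) : Set L.geomJ) ∧
          (∀ g : N, IsOfFinOrder g → g = 1) ∧ D ≤ N
  | .deOrb, L, L' => ∃ φ : L.grp →ₜ* L'.grp, Function.Surjective φ ∧ RigCompat L L' φ ∧
      ∃ A : Subgroup L.grp, A ≤ L.geomJ ∧ (A : Set L.grp).Finite ∧ IsClosed (A : Set L.grp) ∧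
        KerTopNormallyGeneratedBy φ A

end ChainGroup

/-- [AbsTopI] Def 4.2 (iii): a *Π-chain* of length `n`, `Π₀ ⇝ Π₁ ⇝ ⋯ ⇝ Πₙ`, with `Π₀ = Π` and
each step an elementary operation; `types` is its associated type-chain.  Relative to cuspidal
data `C` (for the operations of type •) and the slimness inputs of `ChainGroup.self`.
[cite: MochizukiAbsTopI2012, Def 4.2 (iii) p.49] -/
structure PiChain (C : CuspidalData E) (hP : IsSlimGroup E.arith) (hΔ : IsSlimGroup E.geom)
    (hne : E.geom ≠ ⊥) : Type (u + 1) where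
  /-- the length `n` -/
  len : ℕ
  /-- the terms `Π₀, …, Πₙ` -/
  term : Fin (len + 1) → E.ChainGroup
  /-- (0_Π) `Π₀ = Π` -/
  term_zero : term 0 = ChainGroup.self hP hΔ hne
  /-- the associated type-chain -/
  types : Fin len → ElemOpType
  /-- (4_Π) each `Πⱼ ⇝ Πⱼ₊₁` is an elementary operation of the recorded type -/
  isElemOp : ∀ j : Fin len, ChainGroup.IsElemOp C (types j) (term j.castSucc) (term j.succ)

namespace PiChain

variable {E} {C : CuspidalData E} {hP : IsSlimGroup E.arith} {hΔ : IsSlimGroup E.geom}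
  {hne : E.geom ≠ ⊥}

/-- The associated type-chain as a list. [cite: MochizukiAbsTopI2012, Def 4.2 (iii) p.50] -/
def typeChain (c : E.PiChain C hP hΔ hne) : TypeChain := List.ofFn c.types

/-- The last term `Πₙ` of a chain. [cite: MochizukiAbsTopI2012, Def 4.2 (iv) p.50] -/
def last (c : E.PiChain C hP hΔ hne) : E.ChainGroup := c.term (Fin.last _)

/-- [AbsTopI] Def 4.2 (iv): a *terminal homomorphism* of Π-chains is "an open outer homomorphism
`Πₙ → Ψₘ` that is compatible [up to composition with an inner automorphism] with the open
homomorphisms `Πₙ → G`, `Ψₘ → G`"; typed as the existence of a representative `φ` with open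
image and `projΨ ∘ φ = conj(g) ∘ projΠ` for some `g ∈ G`.  `Chain^{trm}(Π)` has these as
morphisms; `Chain^{iso-trm}(Π)` the terminal isomorphisms. [cite: MochizukiAbsTopI2012, Def 4.2 (iv) p.50] -/
def HasTerminalHom (c c' : E.PiChain C hP hΔ hne) : Prop :=
  ∃ (φ : c.last.grp →ₜ* c'.last.grp) (g : E.gal), IsOpen (Set.range φ) ∧
    ∀ x, c'.last.proj (φ x) = MulAut.conj g (c.last.proj x)

/-- A *terminal isomorphism* (an isomorphism of `Chain^{trm}(Π)`): a terminal homomorphism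
admitting a representative that is an isomorphism of topological groups.
[cite: MochizukiAbsTopI2012, Def 4.2 (iv) p.50] -/
def HasTerminalIso (c c' : E.PiChain C hP hΔ hne) : Prop :=
  ∃ (φ : c.last.grp ≃ₜ* c'.last.grp) (g : E.gal),
    ∀ x, c'.last.proj (φ x) = MulAut.conj g (c.last.proj x)

/-- [AbsTopI] Def 4.2 (v): the full subcategories `Chain^{…}(Π){−}` of chains whose type-chain
only contains the listed symbols; `DLoc(Π) := Chain^{trm}(Π){⋏, •}` and
`ÉtLoc(Π) := Chain^{iso-trm}(Π){⋏, ⋎}` — typed as the predicates "is an object of".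
[cite: MochizukiAbsTopI2012, Def 4.2 (v) p.51] -/
def TypesAmong (c : E.PiChain C hP hΔ hne) (allowed : Set ElemOpType) : Prop :=
  ∀ j, c.types j ∈ allowed

/-- Objects of `DLoc(Π) = Chain^{trm}(Π){⋏, •}`. [cite: MochizukiAbsTopI2012, Def 4.2 (v) p.51] -/
def IsDLocObj (c : E.PiChain C hP hΔ hne) : Prop := c.TypesAmong {.finEtCov, .deCusp}

/-- Objects of `ÉtLoc(Π) = Chain^{iso-trm}(Π){⋏, ⋎}`. [cite: MochizukiAbsTopI2012, Def 4.2 (v) p.51] -/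
def IsEtLocObj (c : E.PiChain C hP hΔ hne) : Prop := c.TypesAmong {.finEtCov, .finEtQuot}

end PiChain

/-! ### [AbsTopI] Lemma 4.5 (Cuspidal decomposition groups) -/

/-- A *group-theoretic cuspidal algorithm* ([AbsTopI] Lemma 4.5 (v): "by allowing `H` to vary,
this yields a ["group-theoretic"] characterization of the decomposition groups of cusps in `Π`";
the "functorial group-theoretic algorithm" of [AbsTopIII] Cor 1.10 (ii), Rmk 1.9.8): a rule
assigning to every extension `1 → Δ → Π → G → 1` a `Π`-conjugation-stable set of closed
subgroups of `Π` ("the cuspidal decomposition groups"), transported along isomorphisms of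
extensions (functoriality).  An OUTPUT/ALGORITHM structure over abstract data (typing policy θ);
that it recovers the geometric cusps is the model-relative predicate `RecoversCusps`.
[cite: MochizukiAbsTopI2012, Lemma 4.5 (v) p.55] -/
structure CuspidalAlgorithm : Type (u + 1) where
  /-- the output: the set of "cuspidal decomposition groups" of `Π` -/
  out : ∀ E : FundamentalExtension.{u}, Set (Subgroup E.arith)
  /-- outputs are closed subgroups -/
  isClosed_of_mem : ∀ (E : FundamentalExtension.{u}) (D : Subgroup E.arith), D ∈ out E →
    IsClosed (D : Set E.arith)
  /-- the output is stable under `Π`-conjugation -/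
  conj_mem : ∀ (E : FundamentalExtension.{u}) (D : Subgroup E.arith) (g : E.arith), D ∈ out E →
    MulAut.conj g • D ∈ out E
  /-- functoriality: an isomorphism `Π_E ≅ Π_F` carrying `Δ_E` onto `Δ_F` carries `out E` onto
  `out F` -/
  transport : ∀ (E F : FundamentalExtension.{u}) (α : E.arith ≃ₜ* F.arith),
    E.geom.map α.toMulEquiv.toMonoidHom = F.geom →
      out F = (fun D => D.map α.toMulEquiv.toMonoidHom) '' out E

variable {E}

/-- [AbsTopI] Lemma 4.5 (i) as a predicate on cuspidal data (construction data prime set `Σ`):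
"`X` is non-proper if and only if every torsion-free pro-`Σ` open subgroup of `Δ` is free pro-`Σ`"
— non-properness read off the cusps (`X` has a cusp). [cite: MochizukiAbsTopI2012, Lemma 4.5 (i) p.54] -/
def CuspidalData.NonProperIffFree (C : CuspidalData E) (S : Set ℕ) : Prop :=
  Nonempty C.Cusp ↔ ∀ H : Subgroup E.arith, H ≤ E.geom → IsOpen ((H.subgroupOf E.geom : Set E.geom)) →
    (∀ g : H, IsOfFinOrder g → g = 1) → IsProSet H S → IsFreePro H S

/-- [AbsTopI] Lemma 4.5 (v) relative to cuspidal data `C` (the model-relative comparison, as a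
predicate): the algorithm's output on `E` is exactly the set of decomposition groups of cusps —
"the set of cusps … is in natural bijective correspondence with the set of conjugacy classes …
of decomposition groups of cusps [as described in (iv)] … compatible with the natural actions by
`Π`". [cite: MochizukiAbsTopI2012, Lemma 4.5 (v) p.55] -/
def CuspidalAlgorithm.RecoversCusps (A : CuspidalAlgorithm.{u}) (E : FundamentalExtension.{u})
    (C : CuspidalData E) : Prop :=
  A.out E = ⋃ x : C.Cusp, C.decompositionClass x

/-- [AbsTopI] Lemma 4.5 (vi) as a predicate on cuspidal data: "Let `I ⊆ Π` be a decomposition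
group of a cusp. Then `I = C_Π(I ∩ Δ)`" — each decomposition group is the commensurator in `Π` of
its inertia group. [cite: MochizukiAbsTopI2012, Lemma 4.5 (vi) p.55] -/
def CuspidalData.DecompEqCommensuratorOfInertia (C : CuspidalData E) : Prop :=
  ∀ x : C.Cusp, C.Dcusp x = Subgroup.Commensurable.commensurator (C.Dcusp x ⊓ E.geom)

/-- Abstract "cusp-count" data for [AbsTopI] Lemma 4.5 (iii)–(iv): for a torsion-free pro-`Σ`
characteristic open subgroup `H ⊆ Δ` with maximal pro-`l` quotient `H ↠ H_*`, the function
`J ↦ d(J) := d_{χ^{cyclo}_G}(J^{ab} ⊗ ℚ_l)` on open subgroups of `H_*` (print: defined via the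
quasi-trivial ranks `τ` of the `ℚ_l[G]`-modules `J^{ab} ⊗ ℚ_l`, Lemma 4.5 (ii), and equal to
"(number of cusps of the covering determined by `J`) − 1" by (iii)).  The representation theory
defining `d` is not typed; `d` enters as data. [cite: MochizukiAbsTopI2012, Lemma 4.5 (iii) p.54] -/
structure CuspCountData (Hstar : Type u) [Group Hstar] [TopologicalSpace Hstar] : Type u where
  /-- `J ↦ d_{χ_G^{cyclo}}(J^{ab} ⊗ ℚ_l)`, on (characteristic) open subgroups `J ⊆ H_*` -/
  d : Subgroup Hstar → ℕ

/-- [AbsTopI] Lemma 4.5 (iv) AS AMENDED in [IUTchI] Rmk 1.2.2 (ii) p. 40 — the group-theoretic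
criterion, as a predicate on a closed subgroup `I ⊆ H_*` (relative to cusp-count data `d` and the
prime `l`): "`I ≅ ℤ_l`" (typed via abc-iut-L4-t6's `AbsTopII.IsFreeProSigmaCyclic {l}`: procyclic
with open-subgroup indices exactly the powers of `l`) and
"`d((I^l·J)^{ab} ⊗ ℚ_l) + 1 < l · {d((I·J)^{ab} ⊗ ℚ_l) + 1}`
[i.e., the covering of curves corresponding to `J ⊆ I·J` is totally ramified at some cusp] for
every characteristic open subgroup `J ⊆ H_*` such that `J ≠ I·J`".  The decomposition groups of
cusps `⊆ H_*` are then "the maximal closed subgroups" satisfying this predicate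
(`IsMaximalCuspidalCandidate`).  The same amendment is item (1) of the author's *Comments on
[AbsTopI]* (January 2024, kurims `Topics in Absolute Anabelian Geometry I (comments).pdf`, lit key
paper:url-95b602ea2aa4): "the final portion of Lemma 4.5 (iv) [from the third sentence] should be
replaced by" exactly this characterisation (cell table lit/AUTHOR-COMMENTS-ERRATA.md §A).
[cite: MochizukiAbsTopI2012, Lemma 4.5 (iv) p.54] [cite: Mochizuki2012, IUTchI Rmk 1.2.2 (ii) p.40] -/
def SatisfiesCuspidalCriterion {Hstar : Type u} [Group Hstar] [TopologicalSpace Hstar]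
    [IsTopologicalGroup Hstar] (l : ℕ) (d : CuspCountData Hstar) (I : Subgroup Hstar) : Prop :=
  IsClosed (I : Set Hstar) ∧ AbsTopII.IsFreeProSigmaCyclic {l} I ∧
    ∀ J : Subgroup Hstar, J.Characteristic → IsOpen (J : Set Hstar) → J ≠ I ⊔ J →
      d.d (Subgroup.closure ((fun x : Hstar => x ^ l) '' (I : Set Hstar)) ⊔ J) + 1 <
        l * (d.d (I ⊔ J) + 1)

/-- The maximal closed subgroups of `H_*` satisfying the (amended) cuspidal criterion — the
output of the characterisation of [AbsTopI] Lemma 4.5 (iv) [as amended in [IUTchI] Rmk 1.2.2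
(ii)]. [cite: MochizukiAbsTopI2012, Lemma 4.5 (iv) p.54] -/
def IsMaximalCuspidalCandidate {Hstar : Type u} [Group Hstar] [TopologicalSpace Hstar]
    [IsTopologicalGroup Hstar] (l : ℕ) (d : CuspCountData Hstar) (I : Subgroup Hstar) : Prop :=
  SatisfiesCuspidalCriterion l d I ∧
    ∀ I' : Subgroup Hstar, SatisfiesCuspidalCriterion l d I' → I ≤ I' → I = I'

/-! ### [AbsAnab] Lemma 1.3.9 (proof) as amended in [IUTchI] Rmk 1.2.2 (i): total ramification -/

/-- Abstract cusp-number data on (the maximal pro-`l` quotient `Δ^{(l)}` of) a geometric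
fundamental group: `r(V)` = the number of cusps of the finite étale covering corresponding to the
open subgroup `V` ("since `rᵢ` may be recovered group-theoretically", [AbsAnab] Lemma 1.3.9,
proof p. 19). [cite: MochizukiAbsAnab2004, Lemma 1.3.9 p.19] -/
structure CuspNumberData (D : Type u) [Group D] [TopologicalSpace D] : Type u where
  /-- `V ↦ r_V`, the number of cusps of the covering determined by `V` -/
  r : Subgroup D → ℕ

/-- The group-theoretic criterion for TOTAL RAMIFICATION of a cyclic covering `Z → V` of degree a
power of `l` (open subgroups `J ≤ V` of `Δ^{(l)}`, `J` normal in `V` with cyclic quotient), in the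
AMENDED form of [IUTchI] Rmk 1.2.2 (i) p. 40 replacing the final portion of the proof of [AbsAnab]
Lemma 1.3.9: "`Zᵢ → Vᵢ` is totally ramified [i.e., at some point of `Zᵢ`] … is easily verified to
be equivalent to the condition that the covering `Zᵢ → Vᵢ` admit a factorization `Zᵢ → Wᵢ → Vᵢ`,
where `Wᵢ → Vᵢ` is finite étale of degree `l`, and `r_{Wᵢ} < l · r_{Vᵢ}`".  ([AbsAnab]'s
original text used the equality `r_Z = deg(Z/V)·(r_V − 1) + 1`, "totally ramified at a single
point and unramified elsewhere".)  The inertia groups of cusps in `Δ^{(l)}` are then "the maximal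
subgroups that correspond to [profinite] coverings satisfying this condition" (with Lemma 1.3.7).
The same replacement is item (3) of the author's *Comments on [AbsAnab]* (June 2016, kurims
`Absolute Anabelian Geometry (comments).pdf`, lit key paper:url-d89aefa65d3b): "the second
paragraph of the proof of Lemma 1.3.9, from the third sentence, should be replaced by" this
characterisation via totally ramified pro-`l` cyclic coverings and `r_{Wᵢ} < l·r_{Vᵢ}`
(cell table lit/AUTHOR-COMMENTS-ERRATA.md §A).
[cite: MochizukiAbsAnab2004, Lemma 1.3.9 p.19] [cite: Mochizuki2012, IUTchI Rmk 1.2.2 (i) p.40] -/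
def TotallyRamifiedCriterion {D : Type u} [Group D] [TopologicalSpace D] (l : ℕ)
    (c : CuspNumberData D) (V J : Subgroup D) : Prop :=
  ∃ W : Subgroup D, J ≤ W ∧ W ≤ V ∧ W.relIndex V = l ∧ c.r W < l * c.r V

/-! ### [AbsTopI] Example 4.8: hyperbolic orbicurves over (generalized) sub-`p`-adic fields

[AbsTopI] Ex 4.8 (i)/(ii) p. 58 ([IUTchI] ×7: "the algorithms of [AbsTopII] Cor 3.3 … are
applicable in light of [AbsTopI] Example 4.8"): for `D = V × F × S` with `V` = hyperbolic
orbicurves, `S` = prime sets containing `p`, and `F` = generalized sub-`p`-adic fields (i) resp.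
sub-`p`-adic fields (ii), the hypotheses of Thm 4.7 (i),(ii) resp. (iii),(iv) hold: `D` is
chain-full, the rel-isom-DGC holds by [Mzk5] Thm 4.12 resp. the rel-hom-DGC by [Mzk3] Thm A, `p`
serves as the prime `l`, and the absolute Galois group of a (generalized) sub-`p`-adic field is slim
([Mzk5] Lemma 4.14, [Mzk3] Lemma 15.8).  These INPUTS are typed by abc-iut-L4-t13 in
`RelativeGrothendieckConjecture.lean` (`IsSubpadicField`, `IsGeneralizedSubpadicField`,
`pGC.Lem_15_8`, `Tpcs.Lem_4_14`, `pGC.ThmA`, `Tpcs.Thm_4_12`, `RelIsomDGC`, `RelHomDGC`, Thm 4.7) and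
are consumed from there by name (no copy here; dedup).  [cite: MochizukiAbsTopI2012, Ex 4.8 p.58] -/

end FundamentalExtension

end Literature.AnabelianGeometry.AbsoluteAnabelian
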